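/-
Copyright: pub-balaban β-flow team, β-FLOW PROVER 4 (unit `b2b-balaban-beta-bflow-p4`, gen 7; coordinator ruling «YM
ACCELERATION» 2026-08-21 item (2), «work behind the as-printed interface»).  Lattice calculus only ([folklore]): tensor
products of the one-dimensional tents of PART 17a and the asymptotics of the pyramid's lattice Dirichlet increment form.
Nothing of Bałaban's model is mentioned here; NOT BetaPertH, NOT continuum, NOT Clay.
-/
import Mathlib
import Summits.QuantumFields.BalabanUV.Beta.EriceTentCalculus

/-!
# `Beta.EriceTentPyramid` — PART 17a′ of the `EriceLoopExpansionD4` series: the pyramid `T_R(x) = ∏_i max(0, R − |x_i|)` on `ℤ^d`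

Pure lattice calculus, [folklore] throughout; sibling of PART 17a `Beta.EriceTentCalculus` (the one-dimensional tent), used by
PART 17 `Beta.EriceZetaSecondMoment`.  With `n_R = Σ_t h_R(t)²`, `d_R(s) = Σ_t (h_R(t) − h_R(t−s))²`, `T_R(x) = ∏_i h_R(x_i)`
and `D_R(z) = Σ_x (T_R(x) − T_R(x − z))²`:
* §3 tensor products over `Fin d` (any finitely supported `h`): support in the box, `Σ_x T(x)T(x−z) = ∏_i Σ_t h(t)h(t−z_i)`,
  `Σ_x T² = n^d`, `D(z) = 2n^d − 2∏_i a(z_i)`, `D(e_μ) = n^{d−1}·d(1)` (the same for every axis), Weierstrass' two-sided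
  product inequality, and `S/d(1) − S²/(4n·d(1)) ≤ D(z)/D(e_μ) ≤ S/d(1)` with `S = Σ_i d(z_i)`.
* §4 the pyramid (`R ≥ 1`, `d ≥ 1`): DOMINATION `0 ≤ D_R(z)/D_R(e_μ) ≤ 2·size(z)³`, the LIMIT `D_R(z)/D_R(e_μ) → Σ_i z_i²`
  (`R → ∞`), the GROWTH `D_R(e_μ) ≥ (R³/4)^{d−1}·2R`, the amplitude `0 ≤ T_R ≤ R^d` and the support.
Def-free: the tent enters as `h` with `∀ t, h t = max 0 (R − |t|)` (a family `g R` in the limit statements).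
-/

namespace Summit.QuantumFields.BalabanUV.Beta.EriceTentPyramid

open Literature.MathematicalPhysics.QuantumFieldTheory.Balaban1983to89
open Literature.MathematicalPhysics.QuantumFieldTheory.Balaban1983to89.Beta
open Literature.MathematicalPhysics.QuantumFieldTheory.Balaban1983to89.Beta.PolarizationSign (size one_le_size size_pos
  abs_apply_le_size)
open Literature.MathematicalPhysics.QuantumFieldTheory.Balaban1983to89.B6BondElimination (unitVec unitVec_apply)
open scoped BigOperators
open Filter Topology

open Summit.QuantumFields.BalabanUV.Beta.EriceTentCalculus

/-! ## §3. Tensor products over `Fin d`: support, autocorrelation, the increment form along an axis -/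

section Product

variable {d : ℕ} {h : ℤ → ℝ} {S : Finset ℤ}

/-- The tensor product `T(x) = ∏_i h(x_i)` vanishes off the box `S^d` if `h` vanishes off `S`. [folklore] -/
theorem prod_eq_zero_of_not_mem_box (hsupp : ∀ t ∉ S, h t = 0) {x : Fin d → ℤ}
    (hx : x ∉ Fintype.piFinset fun _ : Fin d => S) : ∏ i, h (x i) = 0 := by
  rw [Fintype.mem_piFinset, not_forall] at hx
  obtain ⟨i, hi⟩ := hx
  exact Finset.prod_eq_zero (Finset.mem_univ i) (hsupp _ hi)

/-- **The autocorrelation of a tensor product factorizes**: `Σ_x T(x)T(x − z) = ∏_i Σ_t h(t)h(t − z_i)`. [folklore] -/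
theorem tsum_prod_mul_prod_shift (hsupp : ∀ t ∉ S, h t = 0) (z : Fin d → ℤ) :
    ∑' x : Fin d → ℤ, (∏ i, h (x i)) * (∏ i, h ((x - z) i)) = ∏ i, ∑' t, h t * h (t - z i) := by
  classical
  rw [tsum_eq_sum (s := Fintype.piFinset fun _ : Fin d => S) fun x hx => by
    rw [prod_eq_zero_of_not_mem_box hsupp hx, zero_mul]]
  have h1 : ∀ i, ∑' t, h t * h (t - z i) = ∑ t ∈ S, h t * h (t - z i) := fun i =>
    tsum_eq_sum fun t ht => by rw [hsupp t ht, zero_mul]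
  simp_rw [h1]
  rw [Finset.prod_univ_sum]
  refine Finset.sum_congr rfl fun x _ => ?_
  rw [← Finset.prod_mul_distrib]
  rfl

/-- The square mass of a tensor product: `Σ_x T(x)² = (Σ_t h(t)²)^d`. [folklore] -/
theorem tsum_prod_sq (hsupp : ∀ t ∉ S, h t = 0) :
    ∑' x : Fin d → ℤ, (∏ i, h (x i)) ^ 2 = (∑' t, h t ^ 2) ^ d := by
  have h1 := tsum_prod_mul_prod_shift (d := d) hsupp 0
  simp only [sub_zero, Pi.zero_apply, ← sq] at h1
  rw [h1, Finset.prod_const, Finset.card_univ, Fintype.card_fin]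

/-- **Polarization for tensor products**: `Σ_x (T(x) − T(x − z))² = 2(Σ_t h²)^d − 2∏_i Σ_t h(t)h(t − z_i)`. [folklore] -/
theorem tsum_sq_prod_sub_shift (hsupp : ∀ t ∉ S, h t = 0) (z : Fin d → ℤ) :
    ∑' x : Fin d → ℤ, (∏ i, h (x i) - ∏ i, h ((x - z) i)) ^ 2
      = 2 * (∑' t, h t ^ 2) ^ d - 2 * ∏ i, ∑' t, h t * h (t - z i) := by
  classical
  have key := tsum_sq_sub_shift_eq (f := fun x : Fin d → ℤ => ∏ i, h (x i))
    (s := Fintype.piFinset fun _ : Fin d => S) (fun x hx => prod_eq_zero_of_not_mem_box hsupp hx) z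
  rw [key, tsum_prod_sq hsupp, tsum_prod_mul_prod_shift hsupp z]

/-- **The increment form along a coordinate axis**: for `d ≥ 1`,
`Σ_x (T(x) − T(x − e_μ))² = (Σ_t h²)^{d−1} · Σ_t (h(t) − h(t−1))²` — the same for every axis `μ`. [folklore] -/
theorem tsum_sq_prod_sub_unitVec (hd : 1 ≤ d) (hsupp : ∀ t ∉ S, h t = 0) (μ : Fin d) :
    ∑' x : Fin d → ℤ, (∏ i, h (x i) - ∏ i, h ((x - unitVec μ) i)) ^ 2
      = (∑' t, h t ^ 2) ^ (d - 1) * ∑' t, (h t - h (t - 1)) ^ 2 := by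
  classical
  rw [tsum_sq_prod_sub_shift hsupp, tsum_sq_sub_shift_eq (f := h) hsupp 1]
  have hprod : ∏ i, ∑' t, h t * h (t - unitVec μ i)
      = (∑' t, h t * h (t - 1)) * (∑' t, h t ^ 2) ^ (d - 1) := by
    rw [← Finset.mul_prod_erase Finset.univ _ (Finset.mem_univ μ)]
    congr 1
    · simp [unitVec_apply]
    · rw [Finset.prod_congr rfl (g := fun _ => ∑' t, h t ^ 2)]
      · rw [Finset.prod_const, Finset.card_erase_of_mem (Finset.mem_univ μ), Finset.card_univ, Fintype.card_fin]
      · intro i hi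
        have hne : i ≠ μ := Finset.ne_of_mem_erase hi
        simp [unitVec_apply, hne, sq]
  rw [hprod]
  obtain ⟨k, rfl⟩ : ∃ k, d = k + 1 := ⟨d - 1, by omega⟩
  simp only [Nat.add_sub_cancel, pow_succ]
  ring

/-- Weierstrass' product inequality, two-sided: for `0 ≤ ε_i ≤ 1`,
`1 − Σε_i ≤ ∏(1 − ε_i) ≤ 1 − Σε_i + (Σε_i)²/2`. [folklore] -/
theorem prod_one_sub_bounds {ι : Type*} (s : Finset ι) {ε : ι → ℝ} (h0 : ∀ i ∈ s, 0 ≤ ε i)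
    (h1 : ∀ i ∈ s, ε i ≤ 1) :
    1 - ∑ i ∈ s, ε i ≤ ∏ i ∈ s, (1 - ε i) ∧
      ∏ i ∈ s, (1 - ε i) ≤ 1 - ∑ i ∈ s, ε i + (∑ i ∈ s, ε i) ^ 2 / 2 := by
  classical
  induction s using Finset.induction_on with
  | empty => simp
  | @insert a s ha ih =>
    have h0a : 0 ≤ ε a := h0 a (Finset.mem_insert_self a s)
    have h1a : ε a ≤ 1 := h1 a (Finset.mem_insert_self a s)
    obtain ⟨ihl, ihu⟩ := ih (fun i hi => h0 i (Finset.mem_insert_of_mem hi)) (fun i hi => h1 i (Finset.mem_insert_of_mem hi))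
    have hS0 : 0 ≤ ∑ i ∈ s, ε i := Finset.sum_nonneg fun i hi => h0 i (Finset.mem_insert_of_mem hi)
    rw [Finset.prod_insert ha, Finset.sum_insert ha]
    set P := ∏ i ∈ s, (1 - ε i)
    set T := ∑ i ∈ s, ε i
    constructor
    · have : (1 - ε a) * (1 - T) ≤ (1 - ε a) * P := mul_le_mul_of_nonneg_left ihl (by linarith)
      nlinarith
    · have : (1 - ε a) * P ≤ (1 - ε a) * (1 - T + T ^ 2 / 2) := mul_le_mul_of_nonneg_left ihu (by linarith)
      nlinarith [sq_nonneg (ε a), mul_nonneg h0a (sq_nonneg T)]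

/-- **The increment form of a tensor product against its axis value**, two-sided: with `n = Σ h² > 0`, one-dimensional
increments `0 ≤ δ_i ≤ 2n` (so that `Σ_t h(t)h(t − z_i) = n − δ_i/2 ≥ 0`) and `d₁ > 0`, the quantity
`D = 2n^d − 2∏_i (n − δ_i/2)` satisfies `S/d₁ − S²/(4 n d₁) ≤ D/(n^{d−1} d₁) ≤ S/d₁`, `S = Σ_i δ_i` (`d ≥ 1`). [folklore] -/
theorem incr_ratio_bounds (hd : 1 ≤ d) {n d₁ : ℝ} (hn : 0 < n) (hd₁ : 0 < d₁) {δ : Fin d → ℝ}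
    (hδ0 : ∀ i, 0 ≤ δ i) (hδn : ∀ i, δ i ≤ 2 * n) :
    (∑ i, δ i) / d₁ - (∑ i, δ i) ^ 2 / (4 * n * d₁) ≤ (2 * n ^ d - 2 * ∏ i, (n - δ i / 2)) / (n ^ (d - 1) * d₁) ∧
      (2 * n ^ d - 2 * ∏ i, (n - δ i / 2)) / (n ^ (d - 1) * d₁) ≤ (∑ i, δ i) / d₁ := by
  obtain ⟨k, rfl⟩ : ∃ k, d = k + 1 := ⟨d - 1, by omega⟩
  simp only [Nat.add_sub_cancel]
  have hε := prod_one_sub_bounds (Finset.univ : Finset (Fin (k + 1))) (ε := fun i => δ i / (2 * n))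
    (fun i _ => by have := hδ0 i; positivity)
    (fun i _ => by rw [div_le_one (by positivity)]; exact hδn i)
  rw [← Finset.sum_div] at hε
  obtain ⟨hl, hu⟩ := hε
  set P := ∏ i, (1 - δ i / (2 * n)) with hP
  set S := ∑ i, δ i with hS
  have hprod : ∏ i, (n - δ i / 2) = n ^ (k + 1) * P := by
    have e1 : ∀ i, n - δ i / 2 = n * (1 - δ i / (2 * n)) := fun i => by field_simp
    simp_rw [e1]
    rw [Finset.prod_mul_distrib, Finset.prod_const, Finset.card_univ, Fintype.card_fin]
  have hnk : (0 : ℝ) < n ^ k := pow_pos hn k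
  have e : (2 * n ^ (k + 1) - 2 * (n ^ (k + 1) * P)) / (n ^ k * d₁) = 2 * n * (1 - P) / d₁ := by
    rw [pow_succ]; field_simp
  rw [hprod, e]
  constructor
  · have h2 : S - S ^ 2 / (4 * n) = 2 * n * (S / (2 * n) - (S / (2 * n)) ^ 2 / 2) := by field_simp; ring
    have h3 : S / (2 * n) - (S / (2 * n)) ^ 2 / 2 ≤ 1 - P := by linarith
    calc S / d₁ - S ^ 2 / (4 * n * d₁) = (S - S ^ 2 / (4 * n)) / d₁ := by field_simp
      _ ≤ 2 * n * (1 - P) / d₁ :=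
          div_le_div_of_nonneg_right (by rw [h2]; exact mul_le_mul_of_nonneg_left h3 (by positivity)) hd₁.le
  · have h3 : 1 - P ≤ S / (2 * n) := by linarith
    calc 2 * n * (1 - P) / d₁ ≤ 2 * n * (S / (2 * n)) / d₁ :=
          div_le_div_of_nonneg_right (mul_le_mul_of_nonneg_left h3 (by positivity)) hd₁.le
      _ = S / d₁ := by field_simp

end Product

/-! ## §4. The pyramid `T_R(x) = ∏_i max(0, R − |x_i|)`: domination, limit, growth, amplitude -/

section Pyramid

variable {d R : ℕ} {h : ℤ → ℝ}

/-- The polynomial weight of the domination: `Σ_i (2 + |z_i|) z_i² ≤ 2·size(z)³`. [folklore] -/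
theorem sum_weight_le_size_cube (z : Fin d → ℤ) :
    ∑ i, (2 + |(z i : ℝ)|) * (z i : ℝ) ^ 2 ≤ 2 * size z ^ 3 := by
  have hs : size z = 1 + ∑ i, |(z i : ℝ)| := rfl
  set σ := ∑ i, |(z i : ℝ)| with hσ
  have hσ0 : 0 ≤ σ := Finset.sum_nonneg fun i _ => abs_nonneg _
  have hzi : ∀ i, |(z i : ℝ)| ≤ σ := fun i =>
    Finset.single_le_sum (f := fun j => |(z j : ℝ)|) (fun j _ => abs_nonneg _) (Finset.mem_univ i)
  have h1 : ∑ i, (2 + |(z i : ℝ)|) * (z i : ℝ) ^ 2 ≤ (2 + σ) * σ ^ 2 := by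
    calc ∑ i, (2 + |(z i : ℝ)|) * (z i : ℝ) ^ 2 ≤ ∑ i, (2 + σ) * |(z i : ℝ)| ^ 2 :=
          Finset.sum_le_sum fun i _ => by
            rw [sq_abs]; exact mul_le_mul_of_nonneg_right (by linarith [hzi i]) (sq_nonneg _)
      _ = (2 + σ) * ∑ i, |(z i : ℝ)| ^ 2 := by rw [Finset.mul_sum]
      _ ≤ (2 + σ) * σ ^ 2 := by
          refine mul_le_mul_of_nonneg_left ?_ (by linarith)
          -- Σ_i |z_i|² ≤ (Σ_i |z_i|)² (nonnegative terms; the tree's `LiSinai.sum_sq_le_sq_sum` in a barrier file, inlined)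
          calc ∑ i, |(z i : ℝ)| ^ 2 ≤ ∑ i, |(z i : ℝ)| * σ :=
                Finset.sum_le_sum fun i _ => by rw [sq]; exact mul_le_mul_of_nonneg_left (hzi i) (abs_nonneg _)
            _ = σ ^ 2 := by rw [← Finset.sum_mul, sq]
  rw [hs]; nlinarith

/-- One-dimensional ratio domination: for `R ≥ 1`, `d_R(s)/d_R(1) ≤ (2 + |s|)s²`. [folklore] -/
theorem tent_incr_ratio_le (hh : ∀ t, h t = max 0 ((R : ℝ) - |(t : ℝ)|)) (hR : 1 ≤ R) (s : ℤ) :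
    (∑' t, (h t - h (t - s)) ^ 2) / (∑' t, (h t - h (t - 1)) ^ 2) ≤ (2 + |(s : ℝ)|) * (s : ℝ) ^ 2 := by
  have hR0 : (1 : ℝ) ≤ R := by exact_mod_cast hR
  have hd1 := tent_incr_one_ge hh hR
  have hup := tent_incr_le hh s
  rw [div_le_iff₀ (by linarith)]
  have hc : 2 * R + 2 * |(s : ℝ)| + 1 ≤ (2 + |(s : ℝ)|) * (2 * R) := by nlinarith [abs_nonneg (s : ℝ)]
  calc ∑' t, (h t - h (t - s)) ^ 2 ≤ (2 * R + 2 * |(s : ℝ)| + 1) * (s : ℝ) ^ 2 := hup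
    _ ≤ (2 + |(s : ℝ)|) * (2 * R) * (s : ℝ) ^ 2 := mul_le_mul_of_nonneg_right hc (sq_nonneg _)
    _ = (2 + |(s : ℝ)|) * (s : ℝ) ^ 2 * (2 * R) := by ring
    _ ≤ (2 + |(s : ℝ)|) * (s : ℝ) ^ 2 * ∑' t, (h t - h (t - 1)) ^ 2 :=
        mul_le_mul_of_nonneg_left hd1 (by positivity)

/-- The pyramid's increment ratio written through `incr_ratio_bounds`' letters: for the tent `h = h_R`, `R ≥ 1`, `d ≥ 1`,
`D_R(z) = 2n^d − 2∏_i (n − δ_i/2)` with `n = Σ h²`, `δ_i = d_R(z_i)`, and `D_R(e_μ) = n^{d−1}·d_R(1)`. [folklore] -/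
theorem pyramid_incr_eq (hh : ∀ t, h t = max 0 ((R : ℝ) - |(t : ℝ)|)) (z : Fin d → ℤ) :
    ∑' x : Fin d → ℤ, (∏ i, h (x i) - ∏ i, h ((x - z) i)) ^ 2
      = 2 * (∑' t, h t ^ 2) ^ d - 2 * ∏ i, ((∑' t, h t ^ 2) - (∑' t, (h t - h (t - z i)) ^ 2) / 2) := by
  rw [tsum_sq_prod_sub_shift (tent_support hh) z]
  congr 2
  refine Finset.prod_congr rfl fun i _ => ?_
  rw [tsum_mul_shift_eq (tent_support hh) (z i)]; ring

/-- **Domination**: for `R ≥ 1` and every `z`, `0 ≤ D_R(z)/D_R(e_μ) ≤ 2·size(z)³` (uniformly in `R`; `D_R(e_μ) =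
n_R^{d−1} d_R(1)`). [folklore] -/
theorem pyramid_ratio_bounds (hd : 1 ≤ d) (hh : ∀ t, h t = max 0 ((R : ℝ) - |(t : ℝ)|)) (hR : 1 ≤ R)
    (z : Fin d → ℤ) :
    0 ≤ (∑' x : Fin d → ℤ, (∏ i, h (x i) - ∏ i, h ((x - z) i)) ^ 2)
          / ((∑' t, h t ^ 2) ^ (d - 1) * ∑' t, (h t - h (t - 1)) ^ 2) ∧
      (∑' x : Fin d → ℤ, (∏ i, h (x i) - ∏ i, h ((x - z) i)) ^ 2)
          / ((∑' t, h t ^ 2) ^ (d - 1) * ∑' t, (h t - h (t - 1)) ^ 2) ≤ 2 * size z ^ 3 := by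
  have hR0 : (1 : ℝ) ≤ R := by exact_mod_cast hR
  have hn : 0 < ∑' t, h t ^ 2 := lt_of_lt_of_le (by positivity) (tent_sq_sum_ge hh)
  have hd₁ : 0 < ∑' t, (h t - h (t - 1)) ^ 2 := lt_of_lt_of_le (by positivity) (tent_incr_one_ge hh hR)
  refine ⟨div_nonneg (tsum_nonneg fun x => sq_nonneg _) (by positivity), ?_⟩
  rw [pyramid_incr_eq hh z]
  have hb := (incr_ratio_bounds hd hn hd₁ (δ := fun i => ∑' t, (h t - h (t - z i)) ^ 2)
    (fun i => tsum_nonneg fun t => sq_nonneg _)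
    (fun i => by
      have h0 := tsum_mul_shift_nonneg (tent_nonneg hh) (z i)
      rw [tsum_mul_shift_eq (tent_support hh) (z i)] at h0
      linarith)).2
  refine hb.trans ?_
  rw [Finset.sum_div]
  exact (Finset.sum_le_sum fun i _ => tent_incr_ratio_le hh hR (z i)).trans (sum_weight_le_size_cube z)

/-- **The limit**: `D_R(z)/D_R(e_μ) → Σ_i z_i²` as `R → ∞` (tents as a family `g R`; `d ≥ 1`). [folklore] -/
theorem tendsto_pyramid_ratio (hd : 1 ≤ d) (g : ℕ → ℤ → ℝ) (hg : ∀ R t, g R t = max 0 ((R : ℝ) - |(t : ℝ)|))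
    (z : Fin d → ℤ) :
    Tendsto (fun R : ℕ => (∑' x : Fin d → ℤ, (∏ i, g R (x i) - ∏ i, g R ((x - z) i)) ^ 2)
        / ((∑' t, g R t ^ 2) ^ (d - 1) * ∑' t, (g R t - g R (t - 1)) ^ 2))
      atTop (𝓝 (∑ i, (z i : ℝ) ^ 2)) := by
  -- upper envelope U_R = Σ_i d_R(z_i)/d_R(1) → Σ_i z_i²
  set U : ℕ → ℝ := fun R => ∑ i, (∑' t, (g R t - g R (t - z i)) ^ 2) / (∑' t, (g R t - g R (t - 1)) ^ 2) with hU
  have hUlim : Tendsto U atTop (𝓝 (∑ i, (z i : ℝ) ^ 2)) :=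
    tendsto_finsetSum _ fun i _ => tendsto_tent_incr_ratio g hg (z i)
  -- error envelope E_R ≤ K²/(2R)
  set K : ℝ := ∑ i, (3 + 2 * |(z i : ℝ)|) * (z i : ℝ) ^ 2 with hK
  have hK0 : 0 ≤ K := Finset.sum_nonneg fun i _ => by positivity
  set E : ℕ → ℝ := fun R => (∑ i, ∑' t, (g R t - g R (t - z i)) ^ 2) ^ 2
      / (4 * (∑' t, g R t ^ 2) * ∑' t, (g R t - g R (t - 1)) ^ 2) with hE
  have hElim : Tendsto E atTop (𝓝 0) := by
    refine squeeze_zero' ?_ ?_ (tendsto_const_div_atTop_nhds_zero_nat (K ^ 2 / 2))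
    · rw [eventually_atTop]; refine ⟨1, fun R hR => ?_⟩
      have hn : 0 < ∑' t, g R t ^ 2 := lt_of_lt_of_le (by positivity) (tent_sq_sum_ge (hg R))
      have hd₁ : 0 < ∑' t, (g R t - g R (t - 1)) ^ 2 := lt_of_lt_of_le (by positivity) (tent_incr_one_ge (hg R) hR)
      positivity
    · rw [eventually_atTop]; refine ⟨1, fun R hR => ?_⟩
      have hR0 : (1 : ℝ) ≤ R := by exact_mod_cast hR
      have hn : (R : ℝ) ^ 3 / 4 ≤ ∑' t, g R t ^ 2 := tent_sq_sum_ge (hg R)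
      have hd₁ : 2 * (R : ℝ) ≤ ∑' t, (g R t - g R (t - 1)) ^ 2 := tent_incr_one_ge (hg R) hR
      have hS : ∑ i, ∑' t, (g R t - g R (t - z i)) ^ 2 ≤ R * K := by
        rw [hK, Finset.mul_sum]
        refine Finset.sum_le_sum fun i _ => (tent_incr_le (hg R) (z i)).trans ?_
        have hc : 2 * R + 2 * |(z i : ℝ)| + 1 ≤ R * (3 + 2 * |(z i : ℝ)|) := by nlinarith [abs_nonneg (z i : ℝ)]
        calc (2 * R + 2 * |(z i : ℝ)| + 1) * (z i : ℝ) ^ 2 ≤ R * (3 + 2 * |(z i : ℝ)|) * (z i : ℝ) ^ 2 :=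
              mul_le_mul_of_nonneg_right hc (sq_nonneg _)
          _ = R * ((3 + 2 * |(z i : ℝ)|) * (z i : ℝ) ^ 2) := by ring
      have hS0 : 0 ≤ ∑ i, ∑' t, (g R t - g R (t - z i)) ^ 2 :=
        Finset.sum_nonneg fun i _ => tsum_nonneg fun t => sq_nonneg _
      have hden : 2 * (R : ℝ) ^ 4 ≤ 4 * (∑' t, g R t ^ 2) * ∑' t, (g R t - g R (t - 1)) ^ 2 := by
        calc 2 * (R : ℝ) ^ 4 = 4 * ((R : ℝ) ^ 3 / 4) * (2 * R) := by ring
          _ ≤ 4 * (∑' t, g R t ^ 2) * ∑' t, (g R t - g R (t - 1)) ^ 2 :=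
              mul_le_mul (by linarith) hd₁ (by positivity) (by positivity)
      calc E R ≤ (R * K) ^ 2 / (2 * (R : ℝ) ^ 4) := by
            rw [hE]
            exact div_le_div₀ (by positivity) (pow_le_pow_left₀ hS0 hS 2) (by positivity) hden
        _ = K ^ 2 / 2 / R ^ 2 := by field_simp
        _ ≤ K ^ 2 / 2 / R := div_le_div_of_nonneg_left (by positivity) (by positivity) (by nlinarith)
  -- squeeze between U − E and U
  refine tendsto_of_tendsto_of_tendsto_of_le_of_le' (by simpa using hUlim.sub hElim) hUlim ?_ ?_
  · rw [eventually_atTop]; refine ⟨1, fun R hR => ?_⟩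
    have hn : 0 < ∑' t, g R t ^ 2 := lt_of_lt_of_le (by positivity) (tent_sq_sum_ge (hg R))
    have hd₁ : 0 < ∑' t, (g R t - g R (t - 1)) ^ 2 := lt_of_lt_of_le (by positivity) (tent_incr_one_ge (hg R) hR)
    have hb := (incr_ratio_bounds hd hn hd₁ (δ := fun i => ∑' t, (g R t - g R (t - z i)) ^ 2)
      (fun i => tsum_nonneg fun t => sq_nonneg _)
      (fun i => by
        have h0 := tsum_mul_shift_nonneg (tent_nonneg (hg R)) (z i)
        rw [tsum_mul_shift_eq (tent_support (hg R)) (z i)] at h0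
        linarith)).1
    rw [pyramid_incr_eq (hg R) z]
    simp only [hU, hE, Finset.sum_div] at hb ⊢
    exact hb
  · rw [eventually_atTop]; refine ⟨1, fun R hR => ?_⟩
    have hn : 0 < ∑' t, g R t ^ 2 := lt_of_lt_of_le (by positivity) (tent_sq_sum_ge (hg R))
    have hd₁ : 0 < ∑' t, (g R t - g R (t - 1)) ^ 2 := lt_of_lt_of_le (by positivity) (tent_incr_one_ge (hg R) hR)
    have hb := (incr_ratio_bounds hd hn hd₁ (δ := fun i => ∑' t, (g R t - g R (t - z i)) ^ 2)
      (fun i => tsum_nonneg fun t => sq_nonneg _)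
      (fun i => by
        have h0 := tsum_mul_shift_nonneg (tent_nonneg (hg R)) (z i)
        rw [tsum_mul_shift_eq (tent_support (hg R)) (z i)] at h0
        linarith)).2
    rw [pyramid_incr_eq (hg R) z]
    simp only [hU, Finset.sum_div] at hb ⊢
    exact hb

/-- **Growth**: `D_R(e_μ) = n_R^{d−1}·d_R(1) ≥ (R³/4)^{d−1}·2R` (`R ≥ 1`). [folklore] -/
theorem pyramid_axis_incr_ge (hh : ∀ t, h t = max 0 ((R : ℝ) - |(t : ℝ)|)) (hR : 1 ≤ R) :
    ((R : ℝ) ^ 3 / 4) ^ (d - 1) * (2 * R) ≤ (∑' t, h t ^ 2) ^ (d - 1) * ∑' t, (h t - h (t - 1)) ^ 2 :=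
  mul_le_mul (pow_le_pow_left₀ (by positivity) (tent_sq_sum_ge hh) _) (tent_incr_one_ge hh hR) (by positivity)
    (by positivity)

/-- **Amplitude**: `0 ≤ T_R(x) ≤ R^d`. [folklore] -/
theorem pyramid_amplitude (hh : ∀ t, h t = max 0 ((R : ℝ) - |(t : ℝ)|)) (x : Fin d → ℤ) :
    0 ≤ ∏ i, h (x i) ∧ ∏ i, h (x i) ≤ (R : ℝ) ^ d := by
  refine ⟨Finset.prod_nonneg fun i _ => tent_nonneg hh _, ?_⟩
  calc ∏ i, h (x i) ≤ ∏ _i : Fin d, (R : ℝ) :=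
        Finset.prod_le_prod (fun i _ => tent_nonneg hh _) fun i _ => tent_le hh _
    _ = (R : ℝ) ^ d := by rw [Finset.prod_const, Finset.card_univ, Fintype.card_fin]

/-- **Support**: `T_R(x) ≠ 0` only inside the box `[−R, R]^d`. [folklore] -/
theorem pyramid_support (hh : ∀ t, h t = max 0 ((R : ℝ) - |(t : ℝ)|)) {x : Fin d → ℤ}
    (hx : x ∉ Fintype.piFinset fun _ : Fin d => Finset.Icc (-(R : ℤ)) R) : ∏ i, h (x i) = 0 :=
  prod_eq_zero_of_not_mem_box (tent_support hh) hx

end Pyramid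

end Summit.QuantumFields.BalabanUV.Beta.EriceTentPyramid
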